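import Mathlib.FieldTheory.PurelyInseparable.Basic
import Mathlib.RingTheory.TensorProduct.Basic
import Mathlib.RingTheory.Nilpotent.Lemmas
import Mathlib.Algebra.CharP.Lemmas
import HarnessLib

/-!
# Base change along a purely inseparable extension: compositum fields and radicial algebras

Topic: `Literature/AlgebraicGeometry/Resolution`. Two pieces of classical commutative algebra used
tacitly in M. Temkin, *Inseparable local uniformization*, J. Algebra 373 (2013) 65–119 =
arXiv:0804.1554v3, whenever a ground field is replaced by a finite purely inseparable extension
(proof of Thm. 4.1.1, Step 0, p. 47: "`Nr_F(Y) →~ Y′`"; Lemma 2.8.5, p. 31: "Note that the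
composite extensions `k′k(X)` and `k′k(Y)` are well defined since `k′/k(S)` is purely
inseparable … The morphisms `X′ → X`, `Y′ → Y` and `Z′ → Z` are bijective"), PROVED here in
Mathlib's vocabulary, as building blocks for the corrected Lemma 2.8.5
(`Temkin2013_Lemma285_normal`, `SmoothEquivalenceNormalization.lean`):

* **Compositum with a purely inseparable extension.** For fields `κ ⊆ K`, `k′/κ` purely
  inseparable and a `K`-algebra `T` with a compatible map `k′ → T`: by Mathlib's
  `IsPurelyInseparable.exists_pow_pow_mem_range_tensorProduct_of_expChar` every `z ∈ K ⊗_κ k′`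
  has a power `z^{qⁿ}` (`q` the exponential characteristic) of the form `w ⊗ 1`, `w ∈ K`; hence
  (`isNilpotent_of_compositumLift_eq_zero`) the kernel of the multiplication map `K ⊗_κ k′ → T`
  consists of nilpotents as soon as `K → T` is injective, it EQUALS the nilradical when `T` is
  reduced (`ker_compositumLift_eq_nilradical`), every element of `K ⊗_κ k′` is a unit or
  nilpotent (`isUnit_or_isNilpotent`: `K ⊗_κ k′` is a local ring whose maximal ideal is nil —
  Artinian when `[k′ : κ] < ∞` — with residue field the compositum), and the multiplication map
  onto a field `K′ = K·k′` generated by `k′` over `K` is surjective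
  (`compositumLift_surjective_of_adjoin_eq_top`): the compositum `K·k′` "is well defined",
  `K′ ≅ (K ⊗_κ k′)_red`, and `K′/K` is again of exponent `q^∞`
  (`exists_pow_mem_range_of_adjoin_eq_top`).
* **Radicial integral extensions are bijective on spectra** (here: injective; surjectivity is
  lying-over): `eq_of_isPrime_of_comap_eq_of_forall_pow_mem` — if every element of an
  `A`-algebra `A′` has a power `a^{qⁿ}` in the image of `A`, two primes of `A′` with the same
  contraction to `A` coincide ("`X′ → X` is bijective" for `X′ = Nr_{K′}(X)`, `X` normal,
  `K′/K` purely inseparable).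

## Sources

* M. Temkin, *Inseparable local uniformization*, arXiv:0804.1554v3, proof of Thm. 4.1.1 Step 0
  (p. 47) and Lemma 2.8.5 (p. 31).
* N. Bourbaki, *Algèbre*, Ch. V, §7 (purely inseparable = radicial extensions); A. Grothendieck,
  EGA I, 3.5 (radicial morphisms). Everything here is folklore and PROVED.
-/

noncomputable section

open TensorProduct

namespace Literature.AlgebraicGeometry.Resolution

/-! ### Radicial algebras: injectivity on spectra -/

/-- **Primes of a radicial algebra are determined by their contraction**: if every `a ∈ A′`
has some power `a^{qⁿ}` (`q ≥ 1`) in the image of `A`, then two prime ideals of `A′` with the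
same contraction to `A` are equal. (E.g. `A′ = Nr_{K′}(A)` for `A` normal and `K′/K` purely
inseparable: "`X′ → X` is bijective", Temkin 2013, proof of Lemma 2.8.5.) [folklore] -/
theorem eq_of_isPrime_of_comap_eq_of_forall_pow_mem {A A' : Type*} [CommRing A]
    [CommRing A'] [Algebra A A'] {q : ℕ} (hq : 0 < q)
    (h : ∀ a : A', ∃ n : ℕ, a ^ q ^ n ∈ (algebraMap A A').range)
    {P₁ P₂ : Ideal A'} [P₁.IsPrime] [P₂.IsPrime]
    (he : P₁.comap (algebraMap A A') = P₂.comap (algebraMap A A')) : P₁ = P₂ := by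
  suffices key : ∀ (Q₁ Q₂ : Ideal A'), Q₁.IsPrime → Q₂.IsPrime →
      Q₁.comap (algebraMap A A') = Q₂.comap (algebraMap A A') → Q₁ ≤ Q₂ from
    le_antisymm (key P₁ P₂ ‹_› ‹_› he) (key P₂ P₁ ‹_› ‹_› he.symm)
  intro Q₁ Q₂ _ hQ₂ hQ a ha
  obtain ⟨n, b, hb⟩ := h a
  have h1 : a ^ q ^ n ∈ Q₁ := Ideal.pow_mem_of_mem Q₁ ha _ (pow_pos hq n)
  have h2 : b ∈ Q₂.comap (algebraMap A A') := by
    rw [← hQ, Ideal.mem_comap, hb]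
    exact h1
  rw [Ideal.mem_comap, hb] at h2
  exact hQ₂.mem_of_pow_mem _ h2

/-! ### The tensor product with a purely inseparable extension -/

section Compositum

variable {κ K k' T : Type*} [Field κ] [Field K] [Field k'] [CommRing T]
  [Algebra κ K] [Algebra κ k'] [Algebra K T] [Algebra κ T] [IsScalarTower κ K T]

variable [Algebra k' T] [IsScalarTower κ k' T]

variable (κ K k' T) in
/-- The multiplication map `K ⊗_κ k′ → T`, `a ⊗ e ↦ a·e`, for a `K`-algebra `T` with a
compatible `κ`-map `k′ → T` (the would-be compositum). An abbreviation for Mathlib's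
`Algebra.TensorProduct.lift`. [folklore] -/
abbrev compositumLift : K ⊗[κ] k' →ₐ[K] T :=
  Algebra.TensorProduct.lift (Algebra.ofId K T) (IsScalarTower.toAlgHom κ k' T)
    (fun _ _ => Commute.all _ _)

/-- `a ⊗ e ↦ a·e`. [folklore] -/
@[simp] theorem compositumLift_tmul (a : K) (e : k') :
    compositumLift κ K k' T (a ⊗ₜ e) = algebraMap K T a * algebraMap k' T e := by
  simp [compositumLift, Algebra.TensorProduct.lift_tmul, Algebra.ofId_apply]

/-- If `K → T` is injective (e.g. `T` a field) then the kernel of `K ⊗_κ k′ → T` consists of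
nilpotent elements (`k′/κ` purely inseparable). [folklore] -/
theorem isNilpotent_of_compositumLift_eq_zero [IsPurelyInseparable κ k']
    (hinj : Function.Injective (algebraMap K T)) {z : K ⊗[κ] k'}
    (hz : compositumLift κ K k' T z = 0) : IsNilpotent z := by
  obtain ⟨n, w, hw⟩ :=
    IsPurelyInseparable.exists_pow_pow_mem_range_tensorProduct_of_expChar (R := K) (ringExpChar κ) z
  have hw0 : w = 0 := by
    apply hinj
    rw [map_zero]
    have := congrArg (fun t => t ^ ringExpChar κ ^ n) hz
    rw [← map_pow, ← hw, zero_pow (pow_ne_zero n (expChar_pos κ (ringExpChar κ)).ne')] at this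
    simpa [compositumLift_tmul, Algebra.TensorProduct.algebraMap_apply] using this
  exact ⟨ringExpChar κ ^ n, by rw [← hw, hw0, map_zero]⟩

/-- For a REDUCED `T` into which `K` embeds, the kernel of `K ⊗_κ k′ → T` is exactly the
nilradical (`k′/κ` purely inseparable): "`K′ ≅ (K ⊗_κ k′)_red`". [folklore] -/
theorem ker_compositumLift_eq_nilradical [IsPurelyInseparable κ k'] [IsReduced T]
    (hinj : Function.Injective (algebraMap K T)) :
    RingHom.ker (compositumLift κ K k' T : K ⊗[κ] k' →+* T) = nilradical (K ⊗[κ] k') := by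
  ext z
  rw [RingHom.mem_ker, mem_nilradical]
  constructor
  · exact fun hz => isNilpotent_of_compositumLift_eq_zero hinj hz
  · rintro ⟨n, hn⟩
    have : (compositumLift κ K k' T z) ^ n = 0 := by
      rw [← map_pow]
      change (compositumLift κ K k' T : K ⊗[κ] k' →+* T) (z ^ n) = 0
      rw [hn, map_zero]
    exact IsReduced.eq_zero _ ⟨n, this⟩

/-- Every element of `K ⊗_κ k′` (`k′/κ` purely inseparable) is a unit or nilpotent: the ring is
local with nil maximal ideal, its reduction is a field (the compositum `K·k′`). [folklore] -/
theorem isUnit_or_isNilpotent [IsPurelyInseparable κ k'] (z : K ⊗[κ] k') :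
    IsUnit z ∨ IsNilpotent z := by
  obtain ⟨n, w, hw⟩ :=
    IsPurelyInseparable.exists_pow_pow_mem_range_tensorProduct_of_expChar (R := K) (ringExpChar κ) z
  by_cases hw0 : w = 0
  · exact Or.inr ⟨ringExpChar κ ^ n, by rw [← hw, hw0, map_zero]⟩
  · left
    have hu : IsUnit (z ^ ringExpChar κ ^ n) := by
      rw [← hw]
      exact (algebraMap K (K ⊗[κ] k')).isUnit_map (Ne.isUnit hw0)
    exact (isUnit_pow_iff (pow_ne_zero n (expChar_pos κ (ringExpChar κ)).ne')).mp hu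

/-- If the field `K′ ⊇ K` is generated over `K` by the image of `k′`, the multiplication map
`K ⊗_κ k′ → K′` is surjective ("the compositum `K·k′`"). [folklore] -/
theorem compositumLift_surjective_of_adjoin_eq_top
    (hgen : Algebra.adjoin K (Set.range (algebraMap k' T)) = ⊤) :
    Function.Surjective (compositumLift κ K k' T) := by
  rw [← AlgHom.range_eq_top, eq_top_iff, ← hgen, Algebra.adjoin_le_iff]
  rintro _ ⟨e, rfl⟩
  exact ⟨1 ⊗ₜ e, by simp⟩

/-- If `K′` is generated over `K` by the purely inseparable `k′`, then `K′/K` is of exponent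
`q^∞`: every `a ∈ K′` has some `a^{qⁿ} ∈ K` (`q` the exponential characteristic). In particular
`K′/K` is purely inseparable. See also the intermediate-field versions
`isPurelyInseparable_adjoin_of_isPurelyInseparable` (`InseparableLocalUniformizationAbhyankar.lean`)
and Mathlib's `IntermediateField.isPurelyInseparable_adjoin_iff_pow_mem`; the present ring-valued
form applies to any `K`-algebra `T` generated by `k′` (e.g. a compositum inside a larger reduced
ring). [folklore] -/
theorem exists_pow_mem_range_of_adjoin_eq_top [IsPurelyInseparable κ k'] (q : ℕ) [ExpChar κ q]
    (hgen : Algebra.adjoin K (Set.range (algebraMap k' T)) = ⊤) (a : T) :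
    ∃ n : ℕ, a ^ q ^ n ∈ (algebraMap K T).range := by
  obtain ⟨z, rfl⟩ := compositumLift_surjective_of_adjoin_eq_top (κ := κ) hgen a
  obtain ⟨n, w, hw⟩ :=
    IsPurelyInseparable.exists_pow_pow_mem_range_tensorProduct_of_expChar (R := K) q z
  refine ⟨n, w, ?_⟩
  rw [← map_pow, ← hw, Algebra.TensorProduct.algebraMap_apply, Algebra.algebraMap_self,
    RingHom.id_apply, compositumLift_tmul, map_one, mul_one]

end Compositum

end Literature.AlgebraicGeometry.Resolution
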